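import Summits.CriticalPhenomena.PercolationContinuityZ3.Theorems.Transplant.SkelPhiParaCorridorKGY
import HarnessLib

/-!
# N2 (frames-only node `SamePDropOfSkeletonFrm₁`, OPEN), (C)/(R) corridor slots: **THE K-G CORRIDOR SLOT VALUES IN CLOSED FORM, GENERIC IN
# INTEGERS** (first axis) — `Skelφ.kgM₁ / kgE₁ / kgWm₂ / kgWp₂ / kgM₂ / kgX / kgCtr2 / kgHw2`, the discharges `KGRows.kgVals_ok₁` (`ParkOK (kgPark₁ …)`),
# `kgVals_ok₂` (`ParkOK (kgPark₂ …)`), `kgVals_split` (`hsplit`), `kgVals_park` (`hpark`) from the N-FREE input rows `Skelφ.KGRows`, the arrival box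
# at the values (`kgVals_last`), the increment bound `kgX_succ_le` (`Δ := 8R′ + 7ρ + |v|`), and §3 the CENTRING choice of the run length `kgN` by
# `Nat.findGreatest` with its residual (`kgN_spec`).  Second axis: SkelPhiCorridorKGYValues.
Division of labour (lane INBOX 2026-08-23T02:26:53Z stmt-g20 / 02:30:34Z p5-g16): this file is (1), integers only, no ledger names; stmt-g20's (2)
instantiates at the ledger's constants, defines the creep/box slot values from `kgCtr2`/`kgHw2` and the frame→fine readings (`fine_sub_ctr_mem_rd`,
SkelPhiCorridorKGPrism §1), and discharges `KGRows` from the ledger floors.  Recipe (p5-g15 2026-08-23T01:57:53Z v1–v7): `q`, `W`, `N` are inputs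
of the algebra layer; phase 2 (across-parking, `m₁ + 1` hops) stops while the along-extent is still `≥ 2P` (two landing pieces fit in phase 3's start
window), `E₁ := 2A₁ − (m₁+1)·dec₁ ∈ [2P, 2P + dec₁)`, `(Wm₂, Wp₂) := (⌊E₁/2⌋, E₁ − ⌊E₁/2⌋)`; phase 3 (along-parking, `m₂ + 1` strides) runs until
`hpark`; the arrival box is `kgCorrSched_core_last_subset`'s; the run length is the largest with arrival far edge `≤ tgt`.
builds on p205010 (kernel theorem, internal audit signed; external expert review pending) — nothing in this file uses p205010; nothing here is a
claim about the open node `SamePDropOfSkeletonFrm₁`.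
Lane `prim-bschramm`, seat `prim-bschramm-p5` (gen 16; (C) lineage); helper file (`--supports stmt-CriticalPhenomena-4575 --as helper`).
[cite: KozmaNitzan2024, §4 Lemma 12 (pp. 23–25: the target box of a corridor)] [cite: MartineauTassion2017, §4.3 Lemma 4.2 (steering)]
-/

namespace Summit.CriticalPhenomena.PercolationContinuityZ3.Theorems.Transplant

namespace Skelφ

open Literature.Probability.Percolation Literature.Probability.LatticeModels SimpleGraph
open ChainPlanar ChainPara

/-! ## §0 Integer floor bookkeeping -/

/-- `T ≤ d·⌈T/d⌉` with `⌈T/d⌉ := ⌊(T + d − 1)/d⌋`, for `0 < d`. [folklore] -/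
theorem int_ceil_spec (T : ℤ) {d : ℤ} (hd : 0 < d) : T ≤ d * ((T + d - 1) / d) ∧ d * ((T + d - 1) / d) < T + d := by
  have h := And.intro (Int.mul_ediv_add_emod (T + d - 1) d) (And.intro (Int.emod_nonneg (T + d - 1) hd.ne') (Int.emod_lt_of_pos (T + d - 1) hd))
  constructor <;> linarith [h.1, h.2.1, h.2.2]

/-! ## §1 First axis (E-corridor in the frame `runX φ c₀ n hs σ`): the closed terms -/

section KGX

variable (n ℓ : ℕ) (hs v : ℤ) (R' ρ q W N : ℕ)

/-- Rows per long box: `P := ⌊nℓ/U⌋ + 1` (`U := shearUnit n hs`) — the landing pieces of an x-stride, the maximal progress of a y′-hop. [this work] -/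
def kgP : ℕ := n * ℓ / shearUnit n hs + 1

/-- Minimal progress of a y′-hop in rows: `sL := ⌊(nℓ − U + 1)/U⌋`. [this work] -/
def kgSL : ℤ := ((n : ℤ) * ℓ - (shearUnit n hs : ℕ) + 1) / (shearUnit n hs : ℕ)

/-- Contraction per across-parking hop: `dec₁ := sL − 2R′ − ρ`. [this work] -/
def kgDec₁ : ℤ := kgSL n ℓ hs - 2 * R' - ρ

/-- Twice the excess of phase 2's start half-extent over `P`: `T₁ := 2W + 2(N+1)R′` (`= 2A₁ − 2P`). [this work] -/
def kgT₁ : ℤ := 2 * W + 2 * (N + 1) * R'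

/-- **Phase 2's step count** `m₁ := ⌊T₁/dec₁⌋ − 1` (so `m₁ + 1 = ⌊T₁/dec₁⌋ ≥ 1` under the rows). [this work] -/
def kgM₁ : ℕ := (kgT₁ R' W N / kgDec₁ n ℓ hs R' ρ).toNat - 1

/-- **Phase 2's final along-extent** `E₁ := 2A₁ − (m₁+1)·dec₁` (`∈ [2P, 2P + dec₁)`). [this work] -/
def kgE₁ : ℕ := (2 * ((kgA₁ n ℓ hs R' W N : ℕ) : ℤ) - (((kgM₁ n ℓ hs R' ρ W N : ℕ) : ℤ) + 1) * kgDec₁ n ℓ hs R' ρ).toNat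

/-- Phase 3's lower start half-window `Wm₂ := ⌊E₁/2⌋`. [this work] -/
def kgWm₂ : ℕ := kgE₁ n ℓ hs R' ρ W N / 2

/-- Phase 3's upper start half-window `Wp₂ := E₁ − ⌊E₁/2⌋`. [this work] -/
def kgWp₂ : ℕ := kgE₁ n ℓ hs R' ρ W N - kgE₁ n ℓ hs R' ρ W N / 2

/-- Phase 3's start along half-extent `X₂ := q + (N+1)R′ + (m₁+1)(R′ + ρ + |v|)`. [this work] -/
def kgX₂ : ℤ := (q : ℤ) + (N + 1) * R' + ((((kgM₁ n ℓ hs R' ρ W N : ℕ) : ℤ)) + 1) * (R' + ρ + |v|)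

/-- Contraction per along-parking stride: `dec₂ := n − 2R′ − ρ`. [this work] -/
def kgDec₂ : ℤ := (n : ℤ) - 2 * R' - ρ

/-- `T₂ := 2X₂ − (n + ρ − 1)` (what phase 3 must contract). [this work] -/
def kgT₂ : ℤ := 2 * kgX₂ n ℓ hs v R' ρ q W N - ((n : ℤ) + ρ - 1)

/-- **Phase 3's step count** `m₂ := max 1 ⌈T₂/dec₂⌉ − 1`. [this work] -/
def kgM₂ : ℕ := (max 1 ((kgT₂ n ℓ hs v R' ρ q W N + kgDec₂ n R' ρ - 1) / kgDec₂ n R' ρ)).toNat - 1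

/-- **The arrival's along overshoot** `X := X₂ + (m₂+1)(R′+ρ)`: the arrival box is `(N+1)n + [X − (n+ρ−1), X]` along. [this work] -/
def kgX : ℤ := kgX₂ n ℓ hs v R' ρ q W N + ((((kgM₂ n ℓ hs v R' ρ q W N : ℕ) : ℤ)) + 1) * (R' + ρ)

/-- **Twice the arrival's across centre** (rows): `2·aHi₁(m₁+1) − E₁ = 2(A₁ + (m₁+1)(R′+ρ)) − E₁` — the creep of the cell lattice reads this. [this work] -/
def kgCtr2 : ℤ := 2 * (((kgA₁ n ℓ hs R' W N : ℕ) : ℤ) + ((((kgM₁ n ℓ hs R' ρ W N : ℕ) : ℤ)) + 1) * (R' + ρ)) - ((kgE₁ n ℓ hs R' ρ W N : ℕ) : ℤ)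

/-- **Twice the arrival's across half-width** (rows): `E₁ + 2(m₂+1)(R′+ρ)`. [this work] -/
def kgHw2 : ℤ := ((kgE₁ n ℓ hs R' ρ W N : ℕ) : ℤ) + 2 * (((((kgM₂ n ℓ hs v R' ρ q W N : ℕ) : ℤ)) + 1) * (R' + ρ))

/-- **THE INPUT ROWS of the first-axis corridor algebra** (N-free; stmt's (2) discharges them from the ledger floors): the frame rows of the pair
(`1 ≤ n`, `|v| ≤ n`, layer inequality), contraction margins `4R′ + ρ + 1 ≤ sL` and `4R′ + 2ρ + 2 ≤ n`, the zone rows `ρ + |v| ≤ n`, `ρ ≤ P + 1`,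
`ρ ≤ ⌊3nℓ/U⌋ + 1`, the start window rows `n + |v| ≤ q`, `sL ≤ 2W`. [this work] -/
structure KGRows (n ℓ : ℕ) (hs v : ℤ) (R' ρ q W : ℕ) : Prop where
  /-- the pair has positive width -/
  hn : 1 ≤ n
  /-- the drift of a y′-hop is at most the width -/
  hv : |v| ≤ n
  /-- the layer inequality `n + |hs| ≤ nℓ + 1` -/
  hlay : (n + hs.natAbs : ℕ) ≤ (n : ℤ) * ℓ + 1
  /-- contraction margin of the across-parking: `dec₁ = sL − 2R′ − ρ ≥ 2R′ + 1` -/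
  hR₁ : 4 * (R' : ℤ) + ρ + 1 ≤ kgSL n ℓ hs
  /-- contraction margin of the along-parking: `dec₂ = n − 2R′ − ρ ≥ (n + 2)/2` -/
  hR₂ : 4 * R' + 2 * ρ + 2 ≤ n
  /-- zone radius plus drift inside one width -/
  hρv : (ρ : ℤ) + |v| ≤ n
  /-- zone radius at most `P + 1` (so `2P ≥ P + ρ − 1`) -/
  hρP : ρ ≤ kgP n ℓ hs + 1
  /-- zone radius inside the along link box of an x-stride -/
  hρL : ρ ≤ 3 * (n * ℓ) / shearUnit n hs + 1
  /-- the run's start half-window along holds one width plus drift -/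
  hq : (n : ℤ) + |v| ≤ q
  /-- the run's extra transverse half-window is at least half a minimal hop (one across-parking hop is always due) -/
  hW : kgSL n ℓ hs ≤ 2 * W

variable {n ℓ hs v R' ρ q W}

/-- `dec₁ ≥ 2R′ + 1 > 0`. [folklore] -/
theorem KGRows.dec₁_pos (H : KGRows n ℓ hs v R' ρ q W) : 2 * (R' : ℤ) + 1 ≤ kgDec₁ n ℓ hs R' ρ := by
  have := H.hR₁; unfold kgDec₁; linarith

/-- `dec₂ ≥ 2R′ + ρ + 2 > 0` and `2·dec₂ ≥ n + 2`. [folklore] -/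
theorem KGRows.dec₂_pos (H : KGRows n ℓ hs v R' ρ q W) : 2 * (R' : ℤ) + ρ + 2 ≤ kgDec₂ n R' ρ ∧ (n : ℤ) + 2 ≤ 2 * kgDec₂ n R' ρ := by
  have := H.hR₂; unfold kgDec₂; constructor <;> omega

/-- `sL ≥ 0`. [folklore] -/
theorem KGRows.sL_nonneg (H : KGRows n ℓ hs v R' ρ q W) : 0 ≤ kgSL n ℓ hs := by
  have := H.hR₁; have : (0 : ℤ) ≤ R' := by positivity
  have : (0 : ℤ) ≤ ρ := by positivity
  linarith

/-- **`m₁ + 1 = ⌊T₁/dec₁⌋` and `m₁ + 1 ≥ 1`.** [this work] -/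
theorem KGRows.kgM₁_spec (H : KGRows n ℓ hs v R' ρ q W) (N : ℕ) :
    (((kgM₁ n ℓ hs R' ρ W N : ℕ) : ℤ)) + 1 = kgT₁ R' W N / kgDec₁ n ℓ hs R' ρ ∧ 1 ≤ kgT₁ R' W N / kgDec₁ n ℓ hs R' ρ := by
  have hd := H.dec₁_pos
  have hd0 : 0 < kgDec₁ n ℓ hs R' ρ := by linarith
  have hT : kgDec₁ n ℓ hs R' ρ ≤ kgT₁ R' W N := by
    have h1 := H.hW; have : (0 : ℤ) ≤ (N + 1) * R' := by positivity
    unfold kgT₁ kgDec₁ at *; have : (0:ℤ) ≤ ρ := by positivity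
    linarith
  have h1 : 1 ≤ kgT₁ R' W N / kgDec₁ n ℓ hs R' ρ := by
    rw [Int.le_ediv_iff_mul_le hd0]; linarith
  refine ⟨?_, h1⟩
  unfold kgM₁
  have h2 : ((kgT₁ R' W N / kgDec₁ n ℓ hs R' ρ).toNat : ℤ) = kgT₁ R' W N / kgDec₁ n ℓ hs R' ρ := Int.toNat_of_nonneg (by linarith)
  have h3 : 1 ≤ (kgT₁ R' W N / kgDec₁ n ℓ hs R' ρ).toNat := by
    have : (1 : ℤ) ≤ ((kgT₁ R' W N / kgDec₁ n ℓ hs R' ρ).toNat : ℤ) := by rw [h2]; exact h1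
    exact_mod_cast this
  rw [Nat.cast_sub h3]; push_cast; linarith

/-- **`E₁ = 2A₁ − (m₁+1)·dec₁` as an integer, and `2P ≤ E₁ < 2P + dec₁`.** [this work] -/
theorem KGRows.kgE₁_spec (H : KGRows n ℓ hs v R' ρ q W) (N : ℕ) :
    ((kgE₁ n ℓ hs R' ρ W N : ℕ) : ℤ) = 2 * ((kgA₁ n ℓ hs R' W N : ℕ) : ℤ) - ((((kgM₁ n ℓ hs R' ρ W N : ℕ) : ℤ)) + 1) * kgDec₁ n ℓ hs R' ρ ∧
    2 * ((kgP n ℓ hs : ℕ) : ℤ) ≤ ((kgE₁ n ℓ hs R' ρ W N : ℕ) : ℤ) ∧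
    ((kgE₁ n ℓ hs R' ρ W N : ℕ) : ℤ) < 2 * ((kgP n ℓ hs : ℕ) : ℤ) + kgDec₁ n ℓ hs R' ρ := by
  have hd := H.dec₁_pos
  have hd0 : 0 < kgDec₁ n ℓ hs R' ρ := by linarith
  obtain ⟨hm, h1⟩ := H.kgM₁_spec N
  have hfl : kgDec₁ n ℓ hs R' ρ * (kgT₁ R' W N / kgDec₁ n ℓ hs R' ρ) ≤ kgT₁ R' W N ∧
      kgT₁ R' W N < kgDec₁ n ℓ hs R' ρ * (kgT₁ R' W N / kgDec₁ n ℓ hs R' ρ) + kgDec₁ n ℓ hs R' ρ := by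
    have h := And.intro (Int.mul_ediv_add_emod (kgT₁ R' W N) (kgDec₁ n ℓ hs R' ρ))
      (And.intro (Int.emod_nonneg (kgT₁ R' W N) hd0.ne') (Int.emod_lt_of_pos (kgT₁ R' W N) hd0))
    constructor <;> linarith [h.1, h.2.1, h.2.2]
  rw [← hm] at hfl
  have hA : 2 * ((kgA₁ n ℓ hs R' W N : ℕ) : ℤ) = 2 * ((kgP n ℓ hs : ℕ) : ℤ) + kgT₁ R' W N := by
    unfold kgA₁ kgP kgT₁; push_cast; ring
  have hnn : 0 ≤ 2 * ((kgA₁ n ℓ hs R' W N : ℕ) : ℤ) - ((((kgM₁ n ℓ hs R' ρ W N : ℕ) : ℤ)) + 1) * kgDec₁ n ℓ hs R' ρ := by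
    rw [hA]; have : (0 : ℤ) ≤ ((kgP n ℓ hs : ℕ) : ℤ) := by positivity
    nlinarith [hfl.1]
  have hE : ((kgE₁ n ℓ hs R' ρ W N : ℕ) : ℤ) = 2 * ((kgA₁ n ℓ hs R' W N : ℕ) : ℤ) - ((((kgM₁ n ℓ hs R' ρ W N : ℕ) : ℤ)) + 1) * kgDec₁ n ℓ hs R' ρ := by
    unfold kgE₁; exact Int.toNat_of_nonneg hnn
  refine ⟨hE, ?_, ?_⟩
  · rw [hE, hA]; nlinarith [hfl.1]
  · rw [hE, hA]; nlinarith [hfl.2]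

/-- `Wm₂ + Wp₂ = E₁`. [folklore] -/
theorem kgWm₂_add_kgWp₂ (N : ℕ) : kgWm₂ n ℓ hs R' ρ W N + kgWp₂ n ℓ hs R' ρ W N = kgE₁ n ℓ hs R' ρ W N := by
  unfold kgWm₂ kgWp₂; omega

/-- **SLOT LEDGER DISCHARGE, phase 2**: `ParkOK (kgPark₁ … (kgM₁ …))` for every `N`. [this work] -/
theorem KGRows.kgVals_ok₁ (H : KGRows n ℓ hs v R' ρ q W) (N : ℕ) :
    ParkOK (kgPark₁ n ℓ hs v R' ρ q W N (kgM₁ n ℓ hs R' ρ W N)) := by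
  refine kgPark₁_ok _ H.hn H.hv H.hlay ?_ H.hρv ?_
  · have := H.hR₁; unfold kgSL at this; linarith
  · have := H.hq; have : (0 : ℤ) ≤ (N + 1) * R' := by positivity
    linarith

/-- **SLOT LEDGER DISCHARGE, phase 3**: `ParkOK (kgPark₂ … (kgM₁ …) (kgWm₂ …) (kgWp₂ …) (kgM₂ …))` for every `N`. [this work] -/
theorem KGRows.kgVals_ok₂ (H : KGRows n ℓ hs v R' ρ q W) (N : ℕ) :
    ParkOK (kgPark₂ n ℓ hs v R' ρ q W N (kgM₁ n ℓ hs R' ρ W N) (kgWm₂ n ℓ hs R' ρ W N) (kgWp₂ n ℓ hs R' ρ W N)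
      (kgM₂ n ℓ hs v R' ρ q W N)) := by
  refine kgPark₂_ok _ _ H.hn ?_ H.hρL ?_
  · have := H.hR₂; omega
  · rw [kgWm₂_add_kgWp₂]
    have h := (H.kgE₁_spec N).2.1
    unfold kgP at h
    exact_mod_cast h

/-- **THE WINDOW SPLIT `hsplit`**: `Wm₂ + Wp₂ = aHi₁(m₁+1) − aLo₁(m₁+1)` (phase 2's final extent is `E₁` exactly: the `max` of `ParkPrm.extent_eq`
collapses because `E₁ ≥ 2P ≥ P + ρ − 1`). [this work] -/
theorem KGRows.kgVals_split (H : KGRows n ℓ hs v R' ρ q W) (N : ℕ) :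
    ((kgWm₂ n ℓ hs R' ρ W N : ℕ) : ℤ) + (kgWp₂ n ℓ hs R' ρ W N : ℕ) =
      (kgPark₁ n ℓ hs v R' ρ q W N (kgM₁ n ℓ hs R' ρ W N)).aHi (kgM₁ n ℓ hs R' ρ W N + 1) -
        ParkPrm.aLo (kgPark₁ n ℓ hs v R' ρ q W N (kgM₁ n ℓ hs R' ρ W N)) (kgM₁ n ℓ hs R' ρ W N + 1) := by
  have hP := H.kgVals_ok₁ N
  obtain ⟨hE, hE2, _⟩ := H.kgE₁_spec N
  have hρP := H.hρP
  have hPdef : ((kgP n ℓ hs : ℕ) : ℤ) = (n : ℤ) * ℓ / (shearUnit n hs : ℕ) + 1 := by unfold kgP; push_cast; ring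
  have hAP : ((kgP n ℓ hs : ℕ) : ℤ) ≤ ((kgA₁ n ℓ hs R' W N : ℕ) : ℤ) := by
    unfold kgP kgA₁; push_cast
    have : (0 : ℤ) ≤ W := by positivity
    have : (0 : ℤ) ≤ (N + 1) * R' := by positivity
    linarith
  have hρP' : (ρ : ℤ) ≤ ((kgP n ℓ hs : ℕ) : ℤ) + 1 := by exact_mod_cast hρP
  have h0 : (n : ℤ) * ℓ / (shearUnit n hs : ℕ) + 1 + ρ - 1 ≤ 2 * (kgA₁ n ℓ hs R' W N : ℕ) := by rw [← hPdef]; linarith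
  have e := kgPark₁_extent (kgM₁ n ℓ hs R' ρ W N) hP h0 (kgM₁ n ℓ hs R' ρ W N + 1)
  have hsum : ((kgWm₂ n ℓ hs R' ρ W N : ℕ) : ℤ) + (kgWp₂ n ℓ hs R' ρ W N : ℕ) = (kgE₁ n ℓ hs R' ρ W N : ℕ) := by
    exact_mod_cast kgWm₂_add_kgWp₂ (n := n) (ℓ := ℓ) (hs := hs) (R' := R') (ρ := ρ) (W := W) N
  have hE' : ((kgE₁ n ℓ hs R' ρ W N : ℕ) : ℤ) =
      2 * (kgA₁ n ℓ hs R' W N : ℕ) - (((kgM₁ n ℓ hs R' ρ W N + 1 : ℕ) : ℤ)) *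
        (((n : ℤ) * ℓ - (shearUnit n hs : ℕ) + 1) / (shearUnit n hs : ℕ) - 2 * R' - ρ) := by
    rw [hE]; unfold kgDec₁ kgSL; push_cast; ring
  have hfloor : (n : ℤ) * ℓ / (shearUnit n hs : ℕ) + 1 + ρ - 1 ≤
      2 * (kgA₁ n ℓ hs R' W N : ℕ) - (((kgM₁ n ℓ hs R' ρ W N + 1 : ℕ) : ℤ)) *
        (((n : ℤ) * ℓ - (shearUnit n hs : ℕ) + 1) / (shearUnit n hs : ℕ) - 2 * R' - ρ) := by
    rw [← hE', ← hPdef]; linarith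
  rw [e, max_eq_left hfloor, hsum, hE']

/-- **`m₂ + 1 = max 1 ⌈T₂/dec₂⌉`** (as an integer) and the contraction it buys: `T₂ ≤ (m₂+1)·dec₂`. [this work] -/
theorem KGRows.kgM₂_spec (H : KGRows n ℓ hs v R' ρ q W) (N : ℕ) :
    (((kgM₂ n ℓ hs v R' ρ q W N : ℕ) : ℤ)) + 1 =
      max 1 ((kgT₂ n ℓ hs v R' ρ q W N + kgDec₂ n R' ρ - 1) / kgDec₂ n R' ρ) ∧
    kgT₂ n ℓ hs v R' ρ q W N ≤ ((((kgM₂ n ℓ hs v R' ρ q W N : ℕ) : ℤ)) + 1) * kgDec₂ n R' ρ := by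
  have hd := H.dec₂_pos.1
  have hρ0 : (0 : ℤ) ≤ ρ := by positivity
  have hd0 : 0 < kgDec₂ n R' ρ := by linarith
  set c := (kgT₂ n ℓ hs v R' ρ q W N + kgDec₂ n R' ρ - 1) / kgDec₂ n R' ρ with hc
  have hmx : (1 : ℤ) ≤ max 1 c := le_max_left _ _
  have h1 : (((kgM₂ n ℓ hs v R' ρ q W N : ℕ) : ℤ)) + 1 = max 1 c := by
    unfold kgM₂
    have h2 : ((max 1 c).toNat : ℤ) = max 1 c := Int.toNat_of_nonneg (by linarith)
    have h3 : 1 ≤ (max 1 c).toNat := by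
      have : (1 : ℤ) ≤ ((max 1 c).toNat : ℤ) := by rw [h2]; exact hmx
      exact_mod_cast this
    rw [← hc, Nat.cast_sub h3]; push_cast; linarith
  refine ⟨h1, ?_⟩
  rw [h1]
  have hce := (int_ceil_spec (kgT₂ n ℓ hs v R' ρ q W N) hd0).1
  rw [← hc] at hce
  have : c ≤ max 1 c := le_max_right _ _
  nlinarith

/-- **THE PARKING ROW `hpark`** of `kgCorrSched_core_last_subset` at the values. [this work] -/
theorem KGRows.kgVals_park (H : KGRows n ℓ hs v R' ρ q W) (N : ℕ) :
    2 * ((q : ℤ) + (N + 1) * R') + 2 * ((((kgM₁ n ℓ hs R' ρ W N : ℕ) : ℤ)) + 1) * (R' + ρ + |v|) ≤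
      (n : ℤ) + ρ - 1 + ((((kgM₂ n ℓ hs v R' ρ q W N : ℕ) : ℤ)) + 1) * ((n : ℤ) - 2 * R' - ρ) := by
  have h := (H.kgM₂_spec N).2
  unfold kgT₂ kgX₂ kgDec₂ at h
  linarith

/-- **THE ARRIVAL BOX AT THE VALUES** (`kgCorrSched_core_last_subset` with `hpark` discharged): along `y₀ − (N+1)n ∈ [X − (n+ρ−1), X]`, across
`2·y₁ ∈ [Ctr2 − Hw2, Ctr2 + Hw2]`. [cite: KozmaNitzan2024, §4 Lemma 12 (pp. 23–25: the target box)] -/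
theorem KGRows.kgVals_last (H : KGRows n ℓ hs v R' ρ q W) (N : ℕ) {y : Site 2}
    (hy : y ∈ (kgCorrSched (H.kgVals_ok₁ N) (H.kgVals_ok₂ N) (H.kgVals_split N)).core
      ((kgCorrSched (H.kgVals_ok₁ N) (H.kgVals_ok₂ N) (H.kgVals_split N)).N + 1)) :
    (kgX n ℓ hs v R' ρ q W N - ((n : ℤ) + ρ - 1) ≤ y 0 - (N + 1) * n ∧ y 0 - (N + 1) * n ≤ kgX n ℓ hs v R' ρ q W N) ∧
    (kgCtr2 n ℓ hs R' ρ W N - kgHw2 n ℓ hs v R' ρ q W N ≤ 2 * y 1 ∧ 2 * y 1 ≤ kgCtr2 n ℓ hs R' ρ W N + kgHw2 n ℓ hs v R' ρ q W N) := by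
  obtain ⟨⟨h1, h2⟩, h3, h4⟩ := kgCorrSched_core_last_subset (H.kgVals_ok₁ N) (H.kgVals_ok₂ N) (H.kgVals_split N) (H.kgVals_park N) hy
  have hsum : ((kgWm₂ n ℓ hs R' ρ W N : ℕ) : ℤ) + (kgWp₂ n ℓ hs R' ρ W N : ℕ) = (kgE₁ n ℓ hs R' ρ W N : ℕ) := by
    exact_mod_cast kgWm₂_add_kgWp₂ (n := n) (ℓ := ℓ) (hs := hs) (R' := R') (ρ := ρ) (W := W) N
  unfold kgX kgX₂ at *
  unfold kgCtr2 kgHw2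
  refine ⟨⟨by linarith, by linarith⟩, by linarith, by linarith⟩

/-- `⌊(T + a)/d⌋ ≤ ⌊T/d⌋ + 1` for `0 ≤ a < d`. [folklore] -/
theorem int_floor_add_le (T : ℤ) {a d : ℤ} (hd : 0 < d) (ha : a < d) : (T + a) / d ≤ T / d + 1 := by
  have h1 := And.intro (Int.mul_ediv_add_emod T d) (Int.emod_lt_of_pos T hd)
  have h2 := And.intro (Int.mul_ediv_add_emod (T + a) d) (Int.emod_nonneg (T + a) hd.ne')
  have h3 : d * ((T + a) / d) < d * (T / d + 2) := by linarith [h1.1, h1.2, h2.1, h2.2]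
  have h4 := lt_of_mul_lt_mul_left h3 hd.le
  linarith

/-- `⌈(T + a)/d⌉ ≤ ⌈T/d⌉ + k` for `a ≤ k·d` (ceiling as `⌊(· + d − 1)/d⌋`). [folklore] -/
theorem int_ceil_add_le (T : ℤ) {a d k : ℤ} (hd : 0 < d) (ha : a ≤ k * d) : (T + a + d - 1) / d ≤ (T + d - 1) / d + k := by
  have h1 : (T + a + d - 1) / d ≤ (T + d - 1 + k * d) / d := Int.ediv_le_ediv hd (by linarith)
  rw [Int.add_mul_ediv_right _ _ hd.ne'] at h1
  exact h1

/-- **The increment bound of the overshoot in the run length**: `Δ := 8R′ + 7ρ + |v|` (one hop more in phase 2, at most six strides more in phase 3). [this work] -/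
def kgΔ (v : ℤ) (R' ρ : ℕ) : ℤ := 8 * R' + 7 * ρ + |v|

/-- `m₁(N+1) + 1 ≤ (m₁(N) + 1) + 1`. [this work] -/
theorem KGRows.kgM₁_succ_le (H : KGRows n ℓ hs v R' ρ q W) (N : ℕ) :
    (((kgM₁ n ℓ hs R' ρ W (N + 1) : ℕ) : ℤ)) ≤ (kgM₁ n ℓ hs R' ρ W N : ℕ) + 1 := by
  have hd := H.dec₁_pos
  have hd0 : 0 < kgDec₁ n ℓ hs R' ρ := by linarith
  have e0 := (H.kgM₁_spec N).1
  have e1 := (H.kgM₁_spec (N + 1)).1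
  have hT : kgT₁ R' W (N + 1) = kgT₁ R' W N + 2 * R' := by unfold kgT₁; push_cast; ring
  have h := int_floor_add_le (kgT₁ R' W N) hd0 (show 2 * (R' : ℤ) < kgDec₁ n ℓ hs R' ρ by linarith)
  rw [← hT, ← e1, ← e0] at h
  linarith

/-- `m₂(N+1) + 1 ≤ (m₂(N) + 1) + 6`. [this work] -/
theorem KGRows.kgM₂_succ_le (H : KGRows n ℓ hs v R' ρ q W) (N : ℕ) :
    (((kgM₂ n ℓ hs v R' ρ q W (N + 1) : ℕ) : ℤ)) ≤ (kgM₂ n ℓ hs v R' ρ q W N : ℕ) + 6 := by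
  obtain ⟨hd, hd2⟩ := H.dec₂_pos
  have hρ0 : (0 : ℤ) ≤ ρ := by positivity
  have hd0 : 0 < kgDec₂ n R' ρ := by linarith
  obtain ⟨e0, e1, hm₁⟩ := And.intro (H.kgM₂_spec N).1 (And.intro (H.kgM₂_spec (N + 1)).1 (H.kgM₁_succ_le N))
  -- the increase of `T₂`
  set a : ℤ := kgT₂ n ℓ hs v R' ρ q W (N + 1) - kgT₂ n ℓ hs v R' ρ q W N with ha
  obtain ⟨hv, hvn, hR₂⟩ := And.intro H.hv (And.intro (abs_nonneg v) H.hR₂)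
  have ha6 : a ≤ 6 * kgDec₂ n R' ρ := by
    have : a = 2 * R' + 2 * ((((kgM₁ n ℓ hs R' ρ W (N + 1) : ℕ) : ℤ)) - (kgM₁ n ℓ hs R' ρ W N : ℕ)) * (R' + ρ + |v|) := by
      simp only [ha]; unfold kgT₂ kgX₂; push_cast; ring
    rw [this]
    have h1 : ((((kgM₁ n ℓ hs R' ρ W (N + 1) : ℕ) : ℤ)) - (kgM₁ n ℓ hs R' ρ W N : ℕ)) * (R' + ρ + |v|) ≤ 1 * (R' + ρ + |v|) :=
      mul_le_mul_of_nonneg_right (by linarith) (by linarith)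
    unfold kgDec₂; nlinarith
  have h := int_ceil_add_le (kgT₂ n ℓ hs v R' ρ q W N) hd0 ha6
  have hT : kgT₂ n ℓ hs v R' ρ q W N + a = kgT₂ n ℓ hs v R' ρ q W (N + 1) := by simp only [ha]; ring
  rw [hT] at h
  have hmax : max 1 ((kgT₂ n ℓ hs v R' ρ q W (N + 1) + kgDec₂ n R' ρ - 1) / kgDec₂ n R' ρ) ≤
      max 1 ((kgT₂ n ℓ hs v R' ρ q W N + kgDec₂ n R' ρ - 1) / kgDec₂ n R' ρ) + 6 := by
    refine max_le (by linarith [le_max_left (1 : ℤ) ((kgT₂ n ℓ hs v R' ρ q W N + kgDec₂ n R' ρ - 1) / kgDec₂ n R' ρ)]) ?_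
    linarith [le_max_right (1 : ℤ) ((kgT₂ n ℓ hs v R' ρ q W N + kgDec₂ n R' ρ - 1) / kgDec₂ n R' ρ)]
  rw [← e0, ← e1] at hmax
  linarith

/-- **ONE MORE RUN STEP MOVES THE ARRIVAL'S FAR EDGE BY AT MOST `n + Δ`**: `X(N+1) ≤ X(N) + Δ`. [this work] -/
theorem KGRows.kgX_succ_le (H : KGRows n ℓ hs v R' ρ q W) (N : ℕ) :
    kgX n ℓ hs v R' ρ q W (N + 1) ≤ kgX n ℓ hs v R' ρ q W N + kgΔ v R' ρ := by
  obtain ⟨hm₁, hm₂⟩ := And.intro (H.kgM₁_succ_le N) (H.kgM₂_succ_le N)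
  have hρ0 : (0 : ℤ) ≤ ρ := by positivity
  have hvn : (0 : ℤ) ≤ |v| := abs_nonneg v
  unfold kgX kgX₂ kgΔ
  push_cast
  have h1 : ((((kgM₁ n ℓ hs R' ρ W (N + 1) : ℕ) : ℤ)) + 1) * (R' + ρ + |v|) ≤ ((((kgM₁ n ℓ hs R' ρ W N : ℕ) : ℤ)) + 1 + 1) * (R' + ρ + |v|) :=
    mul_le_mul_of_nonneg_right (by linarith) (by linarith)
  have h2 : ((((kgM₂ n ℓ hs v R' ρ q W (N + 1) : ℕ) : ℤ)) + 1) * (R' + ρ) ≤ ((((kgM₂ n ℓ hs v R' ρ q W N : ℕ) : ℤ)) + 1 + 6) * (R' + ρ) :=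
    mul_le_mul_of_nonneg_right (by linarith) (by linarith)
  nlinarith

/-- `0 ≤ X(N)`. [folklore] -/
theorem kgX_nonneg (N : ℕ) : 0 ≤ kgX n ℓ hs v R' ρ q W N := by
  unfold kgX kgX₂; positivity

/-! ## §3 First axis: the centring choice of the run length -/

/-- **The arrival's far edge** after `N + 1` run steps: `f(N) := (N+1)·n + X(N)`. [this work] -/
def kgFar (n ℓ : ℕ) (hs v : ℤ) (R' ρ q W N : ℕ) : ℤ := ((N : ℤ) + 1) * n + kgX n ℓ hs v R' ρ q W N

/-- **THE RUN LENGTH**: the largest `N ≤ ⌊tgt/n⌋` whose arrival far edge is `≤ tgt` (`tgt` = pitch + along slack, stmt's). [this work] -/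
def kgN (n ℓ : ℕ) (hs v : ℤ) (R' ρ q W : ℕ) (tgt : ℤ) : ℕ :=
  Nat.findGreatest (fun N => kgFar n ℓ hs v R' ρ q W N ≤ tgt) (tgt.toNat / n)

/-- **CENTRING**: at `N := kgN … tgt` the arrival far edge lies in `(tgt − n − Δ, tgt]` (so the arrival box `[f − (n+ρ−1), f]` lies in a window of
width `2n + ρ + Δ − 1` ending at `tgt`), provided one run step already fits (`f(0) ≤ tgt`). [this work] -/
theorem KGRows.kgN_spec (H : KGRows n ℓ hs v R' ρ q W) {tgt : ℤ} (h0 : kgFar n ℓ hs v R' ρ q W 0 ≤ tgt) :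
    kgFar n ℓ hs v R' ρ q W (kgN n ℓ hs v R' ρ q W tgt) ≤ tgt ∧
      tgt < kgFar n ℓ hs v R' ρ q W (kgN n ℓ hs v R' ρ q W tgt) + n + kgΔ v R' ρ := by
  have hn := H.hn
  have hn0 : (0 : ℤ) < n := by exact_mod_cast hn
  have hspec : kgFar n ℓ hs v R' ρ q W (kgN n ℓ hs v R' ρ q W tgt) ≤ tgt := by
    unfold kgN
    exact Nat.findGreatest_spec (P := fun N => kgFar n ℓ hs v R' ρ q W N ≤ tgt) (Nat.zero_le _) h0
  refine ⟨hspec, ?_⟩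
  -- one more run step overshoots the target
  have hfail : tgt < kgFar n ℓ hs v R' ρ q W (kgN n ℓ hs v R' ρ q W tgt + 1) := by
    by_contra hcon
    have hle1 : kgFar n ℓ hs v R' ρ q W (kgN n ℓ hs v R' ρ q W tgt + 1) ≤ tgt := not_lt.1 hcon
    by_cases hlt : kgN n ℓ hs v R' ρ q W tgt < tgt.toNat / n
    · exact Nat.findGreatest_is_greatest (P := fun N => kgFar n ℓ hs v R' ρ q W N ≤ tgt) (Nat.lt_succ_self _) hlt hle1
    · have hle : tgt.toNat / n ≤ kgN n ℓ hs v R' ρ q W tgt := not_lt.1 hlt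
      have hX := kgX_nonneg (n := n) (ℓ := ℓ) (hs := hs) (v := v) (R' := R') (ρ := ρ) (q := q) (W := W) (kgN n ℓ hs v R' ρ q W tgt + 1)
      unfold kgFar at hle1
      push_cast at hle1
      have hg0 : (0 : ℤ) ≤ ((kgN n ℓ hs v R' ρ q W tgt : ℕ) : ℤ) := by positivity
      have htgt0 : 0 ≤ tgt := by nlinarith
      have h1 : (tgt.toNat : ℤ) = tgt := Int.toNat_of_nonneg htgt0
      have h2 : tgt.toNat < (tgt.toNat / n + 1) * n := Nat.lt_mul_of_div_lt (Nat.lt_succ_self _) hn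
      have h3 : ((tgt.toNat : ℕ) : ℤ) < (((tgt.toNat / n + 1) * n : ℕ) : ℤ) := by exact_mod_cast h2
      rw [h1] at h3
      push_cast at h3
      have hle' : (((tgt.toNat / n : ℕ) : ℤ)) ≤ (kgN n ℓ hs v R' ρ q W tgt : ℕ) := by exact_mod_cast hle
      have h4 : ((((tgt.toNat / n : ℕ) : ℤ)) + 1) * n ≤ (((kgN n ℓ hs v R' ρ q W tgt : ℕ) : ℤ) + 2) * n :=
        mul_le_mul_of_nonneg_right (by linarith) hn0.le
      nlinarith
  have hinc := H.kgX_succ_le (kgN n ℓ hs v R' ρ q W tgt)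
  unfold kgFar at hfail ⊢
  push_cast at hfail ⊢
  nlinarith

/-- `kgN ≤ ⌊tgt/n⌋`. [folklore] -/
theorem kgN_le (tgt : ℤ) : kgN n ℓ hs v R' ρ q W tgt ≤ tgt.toNat / n := Nat.findGreatest_le _

end KGX

end Skelφ

end Summit.CriticalPhenomena.PercolationContinuityZ3.Theorems.Transplant
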